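import Summits.SmoothPoincare4.SmoothPoincare4.Theorems.ConvexBisectionAcyclicBisectionExistsCrossingStdSymp
import Summits.SmoothPoincare4.SmoothPoincare4.Theorems.ConvexBisectionAcyclicBisectionExistsPicardLefschetzShadow
import HarnessLib

/-!
# Node N1a (M3c) of NF4: Picard–Lefschetz on shadows for a page Dehn twist — LANDED
(wave 5, brick X7-5 = node N1a `node_M3c_shadow_pageDehnTwist` of `NF4_Design.lean` (stub
`stub_modelsOnFibred_of_reach` = NF4 `Literature.Topology.FourManifolds.LefschetzBase.modelsOnFibred_of_reach`),
line `modp-braid-orbits`, crux `ConvexBisection.AcyclicBisectionExists`, item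
stmt-SmoothPoincare4-10508; registered sub-goal `helper_shadow_pageDehnTwist_transvection`)

Let `τ` be a self-map of `Base g` which on the page of direction `c` (`‖c‖ = 1`) is the right-
(`s = true`) resp. left-handed (`s = false`) Dehn twist along the page curve `a`, presented in a
positively oriented smooth annulus chart `φ : ℝ × ℝ → page` around `a` as the shear
`(u, r) ↦ (u ± β r, r)` (`β = 0` below `r = −1/2`, `β = 1` above `r = 1/2`), and the identity on the
rest of the page.  Then for every loop `K` of that page

  **`shadow (τ ∘ K) = transvection (stdSymp ℤ g) (shadow a, s) (shadow K)`**
  `= shadow K + sgn s · stdSymp (shadow a) (shadow K) · shadow a`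

(`shadow_pageDehnTwist_eq_transvection`, `helper_shadow_pageDehnTwist_transvection`): V7's
intermediate form `shadow (τ ∘ K) = shadow K + (sgn s · crossingNumber φ K) • shadow a`
(`helper_shadow_pageDehnTwist`, `…PicardLefschetzShadow.lean`) combined with the now landed
missing lemma `crossingNumber φ K = stdSymp ℤ g (shadow a) (shadow K)`
(`helper_crossingNumber_eq_stdSymp`, `…CrossingStdSymp.lean`) — V7-REPORT §3's one-liner.
Everything is proved; no definitions, no named facts, no `sorry`.  References: B. Farb,
D. Margalit, *A primer on mapping class groups* (2012), Prop. 6.3 [FarbMargalit2012];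
R. E. Gompf, A. I. Stipsicz, *4-Manifolds and Kirby Calculus* (1999), §8.2 [GompfStipsicz1999].
-/

noncomputable section

set_option linter.dupNamespace false

open scoped Manifold ContDiff Topology Real
open Set Function Metric
open Literature.Topology.FourManifolds Literature.Topology.FourManifolds.LefschetzBase
  Literature.GroupTheory.CombinatorialGroupTheory.SignedHurwitz

namespace Summit.SmoothPoincare4.SmoothPoincare4.Theorems.AcyclicBisectionExists.ModpBraidOrbits

/-- **Node N1a (M3c) — Picard–Lefschetz on shadows for a page Dehn twist**, in the exact form of
`node_M3c_shadow_pageDehnTwist` of `NF4_Design.lean`: the homology shadow of the image of a page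
loop `K` under the page Dehn twist along `a` (right-handed for `s = true`) is the signed
transvection `shadow K + sgn s · stdSymp (shadow a) (shadow K) · shadow a`.
[cite: FarbMargalit2012, Prop. 6.3] -/
theorem shadow_pageDehnTwist_eq_transvection (g : ℕ) {c : ℂ} (_hc : ‖c‖ = 1) (τ : Base g → Base g)
    (hτ : Continuous τ) {a : Metric.sphere (0 : EuclideanSpace ℝ (Fin 2)) 1 → Base g}
    (ha : Continuous a) (s : Bool) (φ : ℝ × ℝ → Base g) (β : ℝ → ℝ)
    (_hφs : ContMDiff 𝓘(ℝ, ℝ × ℝ) (𝓡∂ 4) ∞ φ) (_hφ1 : ∀ u r, φ (u + 1, r) = φ (u, r))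
    (_hφa : ∀ u, φ (u, 0) = a (circlePt u)) (_hφp : ∀ p, φ p ∈ page g c)
    (_hφi : InjOn φ (Ico (0 : ℝ) 1 ×ˢ Ioo (-1 : ℝ) 1))
    (_hφo : ∀ u r, r ∈ Ioo (-1 : ℝ) 1 →
      0 < inner ℝ (deriv (fun r' => (φ (u, r')).1) r) (cplxJ (deriv (fun u' => (φ (u', r)).1) u)))
    (_hβs : ContDiff ℝ ∞ β) (_hβ0 : ∀ r ≤ -(1 / 2 : ℝ), β r = 0) (_hβ1 : ∀ r ≥ (1 / 2 : ℝ), β r = 1)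
    (_hτon : ∀ u r, r ∈ Ioo (-1 : ℝ) 1 →
      τ (φ (u, r)) = φ (u + (if s then β r else -β r), r))
    (_hτoff : ∀ p ∈ page g c, p ∉ φ '' (univ ×ˢ Ioo (-1 : ℝ) 1) → τ p = p)
    {K : Metric.sphere (0 : EuclideanSpace ℝ (Fin 2)) 1 → Base g} (hK : Continuous K)
    (_hKc : ∀ θ, K θ ∈ page g c) :
    shadow g (τ ∘ K) (hτ.comp hK) = transvection (stdSymp ℤ g) (shadow g a ha, s) (shadow g K hK) := by
  rw [transvection_apply, helper_shadow_pageDehnTwist g c _hc τ hτ a ha s φ β _hφs _hφ1 _hφa _hφp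
    _hφi _hφo _hβs _hβ0 _hβ1 _hτon _hτoff K hK _hKc,
    helper_crossingNumber_eq_stdSymp g c _hc a ha φ _hφs _hφ1 _hφa _hφp _hφi _hφo K hK _hKc]

/-! ## The registered form -/

/-- **Sub-goal `helper_shadow_pageDehnTwist_transvection`** (X7-5 = node N1a
`node_M3c_shadow_pageDehnTwist` of NF4, fully qualified): Picard–Lefschetz on shadows for a page
Dehn twist — `shadow (τ ∘ K) = transvection (stdSymp ℤ g) (shadow a, s) (shadow K)`.
[cite: FarbMargalit2012, Prop. 6.3] -/
theorem helper_shadow_pageDehnTwist_transvection : ∀ (g : ℕ) (c : ℂ) (_hc : ‖c‖ = 1) (τ : Literature.Topology.FourManifolds.LefschetzBase.Base g → Literature.Topology.FourManifolds.LefschetzBase.Base g) (hτ : Continuous τ) (a : Metric.sphere (0 : EuclideanSpace ℝ (Fin 2)) 1 → Literature.Topology.FourManifolds.LefschetzBase.Base g) (ha : Continuous a) (s : Bool) (φ : ℝ × ℝ → Literature.Topology.FourManifolds.LefschetzBase.Base g) (β : ℝ → ℝ) (_hφs : ContMDiff 𝓘(ℝ, ℝ × ℝ) (𝓡∂ 4)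 ∞ φ) (_hφ1 : ∀ u r, φ (u + 1, r) = φ (u, r)) (_hφa : ∀ u, φ (u, 0) = a (Literature.Topology.FourManifolds.circlePt u)) (_hφp : ∀ p, φ p ∈ Literature.Topology.FourManifolds.LefschetzBase.page g c) (_hφi : Set.InjOn φ (Set.Ico (0 : ℝ) 1 ×ˢ Set.Ioo (-1 : ℝ) 1)) (_hφo : ∀ u r, r ∈ Set.Ioo (-1 : ℝ) 1 → 0 < inner ℝ (deriv (fun r' => (φ (u, r')).1) r) (Literature.Topology.FourManifolds.LefschetzBase.cplxJ (deriv (fun u' => (φ (u', r)).1) u))) (_hβs : ContDiff ℝ ∞ β) (_hβ0 : ∀ r ≤ -(1 / 2 : ℝ), β r = 0) (_hβ1 : ∀ r ≥ (1 / 2 : ℝ), β r = 1) (_hτon : ∀ u r, r ∈ Set.Ioo (-1 : ℝ) 1 → τ (φ (u, r)) = φ (u + (if s then β r else -β r), r)) (_hτoff : ∀ p ∈ Literature.Topology.FourManifolds.LefschetzBase.page g c, p ∉ φ '' (Set.univ ×ˢ Set.Ioo (-1 : ℝ) 1) → τ p = p) (K : Metric.sphere (0 : EuclideanSpace ℝ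 (Fin 2)) 1 → Literature.Topology.FourManifolds.LefschetzBase.Base g) (hK : Continuous K) (_hKc : ∀ θ, K θ ∈ Literature.Topology.FourManifolds.LefschetzBase.page g c), Literature.Topology.FourManifolds.LefschetzBase.shadow g (τ ∘ K) (hτ.comp hK) = Literature.GroupTheory.CombinatorialGroupTheory.SignedHurwitz.transvection (Literature.GroupTheory.CombinatorialGroupTheory.SignedHurwitz.stdSymp ℤ g) (Literature.Topology.FourManifolds.LefschetzBase.shadow g a ha, s) (Literature.Topology.FourManifolds.LefschetzBase.shadow g K hK) :=
  fun g _ hc τ hτ _ ha s φ β hφs hφ1 hφa hφp hφi hφo hβs hβ0 hβ1 hτon hτoff _ hK hKc =>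
    shadow_pageDehnTwist_eq_transvection g hc τ hτ ha s φ β hφs hφ1 hφa hφp hφi hφo hβs hβ0 hβ1
      hτon hτoff hK hKc

end Summit.SmoothPoincare4.SmoothPoincare4.Theorems.AcyclicBisectionExists.ModpBraidOrbits

end
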